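import Mathlib.Tactic.Module
import Literature.NumberTheory.Transcendental.KZRelationsLE
import Literature.NumberTheory.Transcendental.KZSubcalculusInvariants

/-!
# Birth skeleton of the piece `LegendreHeckeTrace` (child of `DeltaRatioHecke`, route HeckeMultiplicityOne; crux-strategist 2026-08-17)

The `T₂` trace identity on `L*(Δ,1)`, `1049[R₁] + 180[R₃] − 3360[R₅] + 13440[R₇] − 11520[R₉] + 1024[R₁₁] ∈ KZ.relations`,
cut into the three Hecke branches. On the λ-line (`t = λ(τ)`, `Δ(τ)dτ ∝ t(1−t)A(t)¹⁰dt` unfolded on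
`(0,1)¹¹`) the branches of `T₂Δ(τ) = 2¹¹Δ(2τ) + ½Δ(τ/2) + ½Δ((τ+1)/2)` are ALGEBRAIC multiples of
`Δ(τ)dτ`: `2¹¹Δ(2τ)/Δ(τ) = 8t²/(1−t)`, `½Δ(τ/2)/Δ(τ) = 8(1−t)²/t`, `½Δ((τ+1)/2)/Δ(τ) = −8/(t(1−t))`,
so with the auxiliary representations on the cube
`u = [8t³·∏a]` (value `1024·I₁`), `w = [8(1−t)³·∏a]` (value `I₁`), `c = [8·∏a]` (value `1049·I₁`),
`a = a(t,xᵢ) = (xᵢ(1−xᵢ)(1−t xᵢ))^{-1/2}`: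
* `stub_landenDescending` — `[u] − 1024·[R₁] ∈ relations` (`∫₀^{i∞}Δ(2τ)dτ = ½∫Δ`: the substitution
  `τ ↦ 2τ` = descending Landen `t ↦ ((1−√(1−t))/(1+√(1−t)))²` as an 11-dim rule-2 move, factorwise
  Gauss/Landen on the ten `x`-slots; value identity `∫t³A¹⁰dt = 128·I₁`, checked to 1e−15);
* `stub_landenAscending` — `[w] − [R₁] ∈ relations` (`τ ↦ τ/2`, ascending Landen; `8∫(1−t)³A¹⁰ = I₁`, checked);
* `stub_cuspHalf` — `[c] + 180[R₃] − 3360[R₅] + 13440[R₇] − 11520[R₉] + 1024[R₁₁] ∈ relations`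
  (the cusp `1/2`: `½∫₀^{i∞}Δ((τ+1)/2)dτ = ∫_{1/2}^{i∞}Δ = P₀ − ∫₀^{1/2}Δ`, Cauchy on the ideal triangle
  `(0, 1/2, i∞)` = ONE zero-bulk Stokes on the unfolded family, and `∫₀^{1/2}Δ = ∫₀^{i∞}Δ(τ)(2τ+1)¹⁰dτ`
  by `γ = (1 0; 2 1)`; imaginary parts; `8∫A¹⁰dt = 1049·I₁`, checked) — THE HARD STUB;
* `stub_eigenIdentity` — `24[R₁] + [u] + [w] − [c] ∈ relations`: the eigen-equation `T₂Δ = −24Δ` IS the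
  polynomial identity `24t(1−t) + 8t³ + 8(1−t)³ = 8`, i.e. integrand additivity (rule 1b) on the cube —
  provable now (cf. `HeckeMultiplicityOne.zsmul_of_sub_sum_of_mem_relations`);
* `stub_auxRepsExist` — `u, w, c` exist (semialgebraic, absolutely integrable: `∫t³A¹⁰`, `∫A¹⁰ < ∞`,
  log¹⁰ tails) — provable now.
Composition: `C1 = ρ_cusp + ρ_eigen − ρ_desc − ρ_asc` (`24 + 1024 + 1 = 1049`).

`lean check`: sorries ONLY in `stub_*`; the composition `LegendreHeckeTrace_of` is a real proof and concludes the
piece's text verbatim (the child item's statement once the split is applied).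
Sources: Manin 1973 §§7–9; Kontsevich–Zagier 2001 §1.2, §3.4; Paşol–Popa arXiv:1202.5802 §5.
-/

noncomputable section

namespace Summit.KontsevichZagierPeriods.KontsevichZagierPeriods.Cruxes.DeltaRatioHecke.HeckeTraceBirth

open Set MeasureTheory
open Literature.NumberTheory.Transcendental
open Literature.NumberTheory.Transcendental.KZ

/-- STUB: descending Landen `τ ↦ 2τ` as moves: `[8t³∏a] − 1024·[R₁] ∈ relations`. [cite: KontsevichZagier2001, §1.2 rule (2)] -/
theorem stub_landenDescending :
    ∀ (r₁ u : Literature.NumberTheory.Transcendental.KZ.IntegralRep 11), r₁.domain = {v | ∀ i, v i ∈ Set.Ioo (0:ℝ) 1} → Set.EqOn r₁.integrand (fun v => v 0 * (1 - v 0) * ∏ i : Fin 10, 1 / Real.sqrt (v i.succ * (1 - v i.succ) * (1 - v 0 * v i.succ))) r₁.domain → u.domain = {v | ∀ i, v i ∈ Set.Ioo (0:ℝ) 1} → Set.EqOn u.integrand (fun v => 8 * v 0 ^ 3 * ∏ i : Fin 10, 1 / Real.sqrt (v i.succ * (1 - v i.succ) * (1 - v 0 * v i.succ))) u.domain → Literature.NumberTheory.Transcendental.KZ.of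 u - (1024 : ℤ) • Literature.NumberTheory.Transcendental.KZ.of r₁ ∈ Literature.NumberTheory.Transcendental.KZ.relations := by
  sorry

/-- STUB: ascending Landen `τ ↦ τ/2` as moves: `[8(1−t)³∏a] − [R₁] ∈ relations`. [cite: KontsevichZagier2001, §1.2 rule (2)] -/
theorem stub_landenAscending :
    ∀ (r₁ w : Literature.NumberTheory.Transcendental.KZ.IntegralRep 11), r₁.domain = {v | ∀ i, v i ∈ Set.Ioo (0:ℝ) 1} → Set.EqOn r₁.integrand (fun v => v 0 * (1 - v 0) * ∏ i : Fin 10, 1 / Real.sqrt (v i.succ * (1 - v i.succ) * (1 - v 0 * v i.succ))) r₁.domain → w.domain = {v | ∀ i, v i ∈ Set.Ioo (0:ℝ) 1} → Set.EqOn w.integrand (fun v => 8 * (1 - v 0) ^ 3 * ∏ i : Fin 10, 1 / Real.sqrt (v i.succ * (1 - v i.succ) * (1 - v 0 * v i.succ))) w.domain → Literature.NumberTheory.Transcendental.KZ.of w - Literature.NumberTheory.Transcendental.KZ.of r₁ ∈ Literature.NumberTheory.Transcendental.KZ.relations := by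
  sorry

/-- STUB (hardest): the cusp `1/2` — Cauchy on `(0, 1/2, i∞)` + the `γ = (1 0; 2 1)` pullback:
`[8∏a] + 180[R₃] − 3360[R₅] + 13440[R₇] − 11520[R₉] + 1024[R₁₁] ∈ relations`. [cite: Manin1973, §§7–9] -/
theorem stub_cuspHalf :
    ∀ (c r₃ r₅ r₇ r₉ r₁₁ : Literature.NumberTheory.Transcendental.KZ.IntegralRep 11), c.domain = {v | ∀ i, v i ∈ Set.Ioo (0:ℝ) 1} → Set.EqOn c.integrand (fun v => (8 : ℝ) * ∏ i : Fin 10, 1 / Real.sqrt (v i.succ * (1 - v i.succ) * (1 - v 0 * v i.succ))) c.domain → r₃.domain = {v | ∀ i, v i ∈ Set.Ioo (0:ℝ) 1} → Set.EqOn r₃.integrand (fun v => v 0 * (1 - v 0) * ∏ i : Fin 10, 1 / Real.sqrt (v i.succ * (1 - v i.succ) * (1 - (if (i : ℕ) < 8 then v 0 else 1 - v 0) * v i.succ))) r₃.domain → r₅.domain = {v | ∀ i, v i ∈ Set.Ioo (0:ℝ) 1} → Set.EqOn r₅.integrand (fun v => v 0 * (1 - v 0) * ∏ i : Fin 10, 1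 / Real.sqrt (v i.succ * (1 - v i.succ) * (1 - (if (i : ℕ) < 6 then v 0 else 1 - v 0) * v i.succ))) r₅.domain → r₇.domain = {v | ∀ i, v i ∈ Set.Ioo (0:ℝ) 1} → Set.EqOn r₇.integrand (fun v => v 0 * (1 - v 0) * ∏ i : Fin 10, 1 / Real.sqrt (v i.succ * (1 - v i.succ) * (1 - (if (i : ℕ) < 4 then v 0 else 1 - v 0) * v i.succ))) r₇.domain → r₉.domain = {v | ∀ i, v i ∈ Set.Ioo (0:ℝ) 1} → Set.EqOn r₉.integrand (fun v => v 0 * (1 - v 0) * ∏ i : Fin 10, 1 / Real.sqrt (v i.succ * (1 - v i.succ) * (1 - (if (i : ℕ) < 2 then v 0 else 1 - v 0) * v i.succ))) r₉.domain → r₁₁.domain = {v | ∀ i, v i ∈ Set.Ioo (0:ℝ) 1} → Set.EqOn r₁₁.integrand (fun v => v 0 * (1 - v 0) * ∏ i : Fin 10, 1 / Real.sqrt (v i.succ * (1 - v i.succ) * (1 - (if (i : ℕ) < 0 then v 0 else 1 - v 0) * v i.succ))) r₁₁.domain → Literature.NumberTheory.Transcendental.KZ.of c + (180 : ℤ) •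 Literature.NumberTheory.Transcendental.KZ.of r₃ - (3360 : ℤ) • Literature.NumberTheory.Transcendental.KZ.of r₅ + (13440 : ℤ) • Literature.NumberTheory.Transcendental.KZ.of r₇ - (11520 : ℤ) • Literature.NumberTheory.Transcendental.KZ.of r₉ + (1024 : ℤ) • Literature.NumberTheory.Transcendental.KZ.of r₁₁ ∈ Literature.NumberTheory.Transcendental.KZ.relations := by
  sorry

/-- STUB (provable now): the eigen-equation `T₂Δ = −24Δ` as integrand additivity,
`24 t(1−t) + 8t³ + 8(1−t)³ = 8` on the cube: `24[R₁] + [u] + [w] − [c] ∈ relations`. [cite: KontsevichZagier2001, §1.2 rule (1)] -/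
theorem stub_eigenIdentity :
    ∀ (r₁ u w c : Literature.NumberTheory.Transcendental.KZ.IntegralRep 11), r₁.domain = {v | ∀ i, v i ∈ Set.Ioo (0:ℝ) 1} → Set.EqOn r₁.integrand (fun v => v 0 * (1 - v 0) * ∏ i : Fin 10, 1 / Real.sqrt (v i.succ * (1 - v i.succ) * (1 - v 0 * v i.succ))) r₁.domain → u.domain = {v | ∀ i, v i ∈ Set.Ioo (0:ℝ) 1} → Set.EqOn u.integrand (fun v => 8 * v 0 ^ 3 * ∏ i : Fin 10, 1 / Real.sqrt (v i.succ * (1 - v i.succ) * (1 - v 0 * v i.succ))) u.domain → w.domain = {v | ∀ i, v i ∈ Set.Ioo (0:ℝ) 1} → Set.EqOn w.integrand (fun v => 8 * (1 - v 0) ^ 3 * ∏ i : Fin 10, 1 / Real.sqrt (v i.succ * (1 - v i.succ) * (1 - v 0 * v i.succ))) w.domain → c.domain = {v | ∀ i, v i ∈ Set.Ioo (0:ℝ) 1} → Set.EqOn c.integrand (fun v => (8 : ℝ) * ∏ i : Fin 10, 1 / Real.sqrt (v i.succ * (1 - v i.succ) * (1 - v 0 * v i.succ))) c.domain → (24 :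 ℤ) • Literature.NumberTheory.Transcendental.KZ.of r₁ + Literature.NumberTheory.Transcendental.KZ.of u + Literature.NumberTheory.Transcendental.KZ.of w - Literature.NumberTheory.Transcendental.KZ.of c ∈ Literature.NumberTheory.Transcendental.KZ.relations := by
  sorry

/-- STUB (provable now): the three auxiliary representations exist. [cite: KontsevichZagier2001, §1.1] -/
theorem stub_auxRepsExist :
    ∃ (u w c : Literature.NumberTheory.Transcendental.KZ.IntegralRep 11), (u.domain = {v | ∀ i, v i ∈ Set.Ioo (0:ℝ) 1} ∧ Set.EqOn u.integrand (fun v => 8 * v 0 ^ 3 * ∏ i : Fin 10, 1 / Real.sqrt (v i.succ * (1 - v i.succ) * (1 - v 0 * v i.succ))) u.domain) ∧ (w.domain = {v | ∀ i, v i ∈ Set.Ioo (0:ℝ) 1} ∧ Set.EqOn w.integrand (fun v => 8 * (1 - v 0) ^ 3 * ∏ i : Fin 10, 1 / Real.sqrt (v i.succ * (1 - v i.succ) * (1 - v 0 * v i.succ))) w.domain) ∧ (c.domain = {v | ∀ i, v i ∈ Set.Ioo (0:ℝ) 1} ∧ Set.EqOn c.integrand (fun v => (8 : ℝ) * ∏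 i : Fin 10, 1 / Real.sqrt (v i.succ * (1 - v i.succ) * (1 - v 0 * v i.succ))) c.domain) := by
  sorry

/-- **Composition (real proof): the five stubs give the piece `LegendreHeckeTrace`** —
`C1 = ρ_cusp + ρ_eigen − ρ_desc − ρ_asc`, `24 + 1024 + 1 = 1049`. [cite: Manin1973, §§7–9] -/
theorem LegendreHeckeTrace_of
    (hA : ∀ (r₁ u : Literature.NumberTheory.Transcendental.KZ.IntegralRep 11), r₁.domain = {v | ∀ i, v i ∈ Set.Ioo (0:ℝ) 1} → Set.EqOn r₁.integrand (fun v => v 0 * (1 - v 0) * ∏ i : Fin 10, 1 / Real.sqrt (v i.succ * (1 - v i.succ) * (1 - v 0 * v i.succ))) r₁.domain → u.domain = {v | ∀ i, v i ∈ Set.Ioo (0:ℝ) 1} → Set.EqOn u.integrand (fun v => 8 * v 0 ^ 3 * ∏ i : Fin 10, 1 / Real.sqrt (v i.succ * (1 - v i.succ) * (1 - v 0 * v i.succ))) u.domain → Literature.NumberTheory.Transcendental.KZ.of u - (1024 : ℤ) • Literature.NumberTheory.Transcendental.KZ.of r₁ ∈ Literature.NumberTheory.Transcendental.KZ.relations)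
    (hB : ∀ (r₁ w : Literature.NumberTheory.Transcendental.KZ.IntegralRep 11), r₁.domain = {v | ∀ i, v i ∈ Set.Ioo (0:ℝ) 1} → Set.EqOn r₁.integrand (fun v => v 0 * (1 - v 0) * ∏ i : Fin 10, 1 / Real.sqrt (v i.succ * (1 - v i.succ) * (1 - v 0 * v i.succ))) r₁.domain → w.domain = {v | ∀ i, v i ∈ Set.Ioo (0:ℝ) 1} → Set.EqOn w.integrand (fun v => 8 * (1 - v 0) ^ 3 * ∏ i : Fin 10, 1 / Real.sqrt (v i.succ * (1 - v i.succ) * (1 - v 0 * v i.succ))) w.domain → Literature.NumberTheory.Transcendental.KZ.of w - Literature.NumberTheory.Transcendental.KZ.of r₁ ∈ Literature.NumberTheory.Transcendental.KZ.relations)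
    (hC : ∀ (c r₃ r₅ r₇ r₉ r₁₁ : Literature.NumberTheory.Transcendental.KZ.IntegralRep 11), c.domain = {v | ∀ i, v i ∈ Set.Ioo (0:ℝ) 1} → Set.EqOn c.integrand (fun v => (8 : ℝ) * ∏ i : Fin 10, 1 / Real.sqrt (v i.succ * (1 - v i.succ) * (1 - v 0 * v i.succ))) c.domain → r₃.domain = {v | ∀ i, v i ∈ Set.Ioo (0:ℝ) 1} → Set.EqOn r₃.integrand (fun v => v 0 * (1 - v 0) * ∏ i : Fin 10, 1 / Real.sqrt (v i.succ * (1 - v i.succ) * (1 - (if (i : ℕ) < 8 then v 0 else 1 - v 0) * v i.succ))) r₃.domain → r₅.domain = {v | ∀ i, v i ∈ Set.Ioo (0:ℝ) 1} → Set.EqOn r₅.integrand (fun v => v 0 * (1 - v 0) * ∏ i : Fin 10, 1 / Real.sqrt (v i.succ * (1 - v i.succ) * (1 - (if (i : ℕ) < 6 then v 0 else 1 - v 0) * v i.succ))) r₅.domain → r₇.domain = {v | ∀ i, v i ∈ Set.Ioo (0:ℝ) 1} → Set.EqOn r₇.integrand (fun v => v 0 * (1 - v 0) * ∏ i : Fin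 10, 1 / Real.sqrt (v i.succ * (1 - v i.succ) * (1 - (if (i : ℕ) < 4 then v 0 else 1 - v 0) * v i.succ))) r₇.domain → r₉.domain = {v | ∀ i, v i ∈ Set.Ioo (0:ℝ) 1} → Set.EqOn r₉.integrand (fun v => v 0 * (1 - v 0) * ∏ i : Fin 10, 1 / Real.sqrt (v i.succ * (1 - v i.succ) * (1 - (if (i : ℕ) < 2 then v 0 else 1 - v 0) * v i.succ))) r₉.domain → r₁₁.domain = {v | ∀ i, v i ∈ Set.Ioo (0:ℝ) 1} → Set.EqOn r₁₁.integrand (fun v => v 0 * (1 - v 0) * ∏ i : Fin 10, 1 / Real.sqrt (v i.succ * (1 - v i.succ) * (1 - (if (i : ℕ) < 0 then v 0 else 1 - v 0) * v i.succ))) r₁₁.domain → Literature.NumberTheory.Transcendental.KZ.of c + (180 : ℤ) • Literature.NumberTheory.Transcendental.KZ.of r₃ - (3360 : ℤ) • Literature.NumberTheory.Transcendental.KZ.of r₅ + (13440 : ℤ) • Literature.NumberTheory.Transcendental.KZ.of r₇ - (11520 : ℤ) • Literature.NumberTheory.Transcendental.KZ.of r₉ + (1024 : ℤ) • Literature.NumberTheory.Transcendental.KZ.of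 r₁₁ ∈ Literature.NumberTheory.Transcendental.KZ.relations)
    (hE : ∀ (r₁ u w c : Literature.NumberTheory.Transcendental.KZ.IntegralRep 11), r₁.domain = {v | ∀ i, v i ∈ Set.Ioo (0:ℝ) 1} → Set.EqOn r₁.integrand (fun v => v 0 * (1 - v 0) * ∏ i : Fin 10, 1 / Real.sqrt (v i.succ * (1 - v i.succ) * (1 - v 0 * v i.succ))) r₁.domain → u.domain = {v | ∀ i, v i ∈ Set.Ioo (0:ℝ) 1} → Set.EqOn u.integrand (fun v => 8 * v 0 ^ 3 * ∏ i : Fin 10, 1 / Real.sqrt (v i.succ * (1 - v i.succ) * (1 - v 0 * v i.succ))) u.domain → w.domain = {v | ∀ i, v i ∈ Set.Ioo (0:ℝ) 1} → Set.EqOn w.integrand (fun v => 8 * (1 - v 0) ^ 3 * ∏ i : Fin 10, 1 / Real.sqrt (v i.succ * (1 - v i.succ) * (1 - v 0 * v i.succ))) w.domain → c.domain = {v | ∀ i, v i ∈ Set.Ioo (0:ℝ) 1} → Set.EqOn c.integrand (fun v => (8 : ℝ) * ∏ i : Fin 10, 1 / Real.sqrt (v i.succ * (1 - v i.succ) * (1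 - v 0 * v i.succ))) c.domain → (24 : ℤ) • Literature.NumberTheory.Transcendental.KZ.of r₁ + Literature.NumberTheory.Transcendental.KZ.of u + Literature.NumberTheory.Transcendental.KZ.of w - Literature.NumberTheory.Transcendental.KZ.of c ∈ Literature.NumberTheory.Transcendental.KZ.relations)
    (hX : ∃ (u w c : Literature.NumberTheory.Transcendental.KZ.IntegralRep 11), (u.domain = {v | ∀ i, v i ∈ Set.Ioo (0:ℝ) 1} ∧ Set.EqOn u.integrand (fun v => 8 * v 0 ^ 3 * ∏ i : Fin 10, 1 / Real.sqrt (v i.succ * (1 - v i.succ) * (1 - v 0 * v i.succ))) u.domain) ∧ (w.domain = {v | ∀ i, v i ∈ Set.Ioo (0:ℝ) 1} ∧ Set.EqOn w.integrand (fun v => 8 * (1 - v 0) ^ 3 * ∏ i : Fin 10, 1 / Real.sqrt (v i.succ * (1 - v i.succ) * (1 - v 0 * v i.succ))) w.domain) ∧ (c.domain = {v | ∀ i, v i ∈ Set.Ioo (0:ℝ) 1} ∧ Set.EqOn c.integrand (fun v => (8 : ℝ) * ∏ i : Fin 10, 1 / Real.sqrt (v i.succ * (1 - v i.succ) * (1 -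 v 0 * v i.succ))) c.domain)) :
    ∀ (r₁ r₃ r₅ r₇ r₉ r₁₁ : Literature.NumberTheory.Transcendental.KZ.IntegralRep 11), r₁.domain = {v | ∀ i, v i ∈ Set.Ioo (0:ℝ) 1} → Set.EqOn r₁.integrand (fun v => v 0 * (1 - v 0) * ∏ i : Fin 10, 1 / Real.sqrt (v i.succ * (1 - v i.succ) * (1 - v 0 * v i.succ))) r₁.domain → r₃.domain = {v | ∀ i, v i ∈ Set.Ioo (0:ℝ) 1} → Set.EqOn r₃.integrand (fun v => v 0 * (1 - v 0) * ∏ i : Fin 10, 1 / Real.sqrt (v i.succ * (1 - v i.succ) * (1 - (if (i : ℕ) < 8 then v 0 else 1 - v 0) * v i.succ))) r₃.domain → r₅.domain = {v | ∀ i, v i ∈ Set.Ioo (0:ℝ) 1} → Set.EqOn r₅.integrand (fun v => v 0 * (1 - v 0) * ∏ i : Fin 10, 1 / Real.sqrt (v i.succ * (1 - v i.succ) * (1 - (if (i : ℕ) < 6 then v 0 else 1 - v 0) * v i.succ))) r₅.domain → r₇.domain = {v | ∀ i, v i ∈ Set.Ioo (0:ℝ) 1} → Set.EqOn r₇.integrand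 (fun v => v 0 * (1 - v 0) * ∏ i : Fin 10, 1 / Real.sqrt (v i.succ * (1 - v i.succ) * (1 - (if (i : ℕ) < 4 then v 0 else 1 - v 0) * v i.succ))) r₇.domain → r₉.domain = {v | ∀ i, v i ∈ Set.Ioo (0:ℝ) 1} → Set.EqOn r₉.integrand (fun v => v 0 * (1 - v 0) * ∏ i : Fin 10, 1 / Real.sqrt (v i.succ * (1 - v i.succ) * (1 - (if (i : ℕ) < 2 then v 0 else 1 - v 0) * v i.succ))) r₉.domain → r₁₁.domain = {v | ∀ i, v i ∈ Set.Ioo (0:ℝ) 1} → Set.EqOn r₁₁.integrand (fun v => v 0 * (1 - v 0) * ∏ i : Fin 10, 1 / Real.sqrt (v i.succ * (1 - v i.succ) * (1 - (if (i : ℕ) < 0 then v 0 else 1 - v 0) * v i.succ))) r₁₁.domain → (1049 : ℤ) • Literature.NumberTheory.Transcendental.KZ.of r₁ + (180 : ℤ) • Literature.NumberTheory.Transcendental.KZ.of r₃ - (3360 : ℤ) • Literature.NumberTheory.Transcendental.KZ.of r₅ + (13440 : ℤ) • Literature.NumberTheory.Transcendental.KZ.of r₇ - (11520 : ℤ) •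 Literature.NumberTheory.Transcendental.KZ.of r₉ + (1024 : ℤ) • Literature.NumberTheory.Transcendental.KZ.of r₁₁ ∈ Literature.NumberTheory.Transcendental.KZ.relations := by
  intro r₁ r₃ r₅ r₇ r₉ r₁₁ hd₁ he₁ hd₃ he₃ hd₅ he₅ hd₇ he₇ hd₉ he₉ hd₁₁ he₁₁
  obtain ⟨u, w, c, ⟨hdu, heu⟩, ⟨hdw, hew⟩, ⟨hdc, hec⟩⟩ := hX
  have ρA := hA r₁ u hd₁ he₁ hdu heu
  have ρB := hB r₁ w hd₁ he₁ hdw hew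
  have ρC := hC c r₃ r₅ r₇ r₉ r₁₁ hdc hec hd₃ he₃ hd₅ he₅ hd₇ he₇ hd₉ he₉ hd₁₁ he₁₁
  have ρE := hE r₁ u w c hd₁ he₁ hdu heu hdw hew hdc hec
  have key : (1049 : ℤ) • of r₁ + (180 : ℤ) • of r₃ - (3360 : ℤ) • of r₅ + (13440 : ℤ) • of r₇
        - (11520 : ℤ) • of r₉ + (1024 : ℤ) • of r₁₁ =
      (of c + (180 : ℤ) • of r₃ - (3360 : ℤ) • of r₅ + (13440 : ℤ) • of r₇ - (11520 : ℤ) • of r₉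
          + (1024 : ℤ) • of r₁₁)
        + ((24 : ℤ) • of r₁ + of u + of w - of c)
        - (of u - (1024 : ℤ) • of r₁) - (of w - of r₁) := by
    module
  rw [key]
  exact relations.sub_mem (relations.sub_mem (relations.add_mem ρC ρE) ρA) ρB

/-- The skeleton closes the piece from the registered stubs. [cite: Manin1973, §§7–9] -/
theorem legendreHeckeTrace_of_stubs : ∀ (r₁ r₃ r₅ r₇ r₉ r₁₁ : Literature.NumberTheory.Transcendental.KZ.IntegralRep 11), r₁.domain = {v | ∀ i, v i ∈ Set.Ioo (0:ℝ) 1} → Set.EqOn r₁.integrand (fun v => v 0 * (1 - v 0) * ∏ i : Fin 10, 1 / Real.sqrt (v i.succ * (1 - v i.succ) * (1 - v 0 * v i.succ))) r₁.domain → r₃.domain = {v | ∀ i, v i ∈ Set.Ioo (0:ℝ) 1} → Set.EqOn r₃.integrand (fun v => v 0 * (1 - v 0) * ∏ i : Fin 10, 1 / Real.sqrt (v i.succ * (1 - v i.succ) * (1 - (if (i : ℕ) < 8 then v 0 else 1 - v 0) * v i.succ))) r₃.domain → r₅.domain = {v | ∀ i, v i ∈ Set.Ioo (0:ℝ) 1}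 → Set.EqOn r₅.integrand (fun v => v 0 * (1 - v 0) * ∏ i : Fin 10, 1 / Real.sqrt (v i.succ * (1 - v i.succ) * (1 - (if (i : ℕ) < 6 then v 0 else 1 - v 0) * v i.succ))) r₅.domain → r₇.domain = {v | ∀ i, v i ∈ Set.Ioo (0:ℝ) 1} → Set.EqOn r₇.integrand (fun v => v 0 * (1 - v 0) * ∏ i : Fin 10, 1 / Real.sqrt (v i.succ * (1 - v i.succ) * (1 - (if (i : ℕ) < 4 then v 0 else 1 - v 0) * v i.succ))) r₇.domain → r₉.domain = {v | ∀ i, v i ∈ Set.Ioo (0:ℝ) 1} → Set.EqOn r₉.integrand (fun v => v 0 * (1 - v 0) * ∏ i : Fin 10, 1 / Real.sqrt (v i.succ * (1 - v i.succ) * (1 - (if (i : ℕ) < 2 then v 0 else 1 - v 0) * v i.succ))) r₉.domain → r₁₁.domain = {v | ∀ i, v i ∈ Set.Ioo (0:ℝ) 1} → Set.EqOn r₁₁.integrand (fun v => v 0 * (1 - v 0) * ∏ i : Fin 10, 1 / Real.sqrt (v i.succ * (1 - v i.succ) * (1 - (if (i : ℕ) < 0 then v 0 else 1 - v 0) * v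 i.succ))) r₁₁.domain → (1049 : ℤ) • Literature.NumberTheory.Transcendental.KZ.of r₁ + (180 : ℤ) • Literature.NumberTheory.Transcendental.KZ.of r₃ - (3360 : ℤ) • Literature.NumberTheory.Transcendental.KZ.of r₅ + (13440 : ℤ) • Literature.NumberTheory.Transcendental.KZ.of r₇ - (11520 : ℤ) • Literature.NumberTheory.Transcendental.KZ.of r₉ + (1024 : ℤ) • Literature.NumberTheory.Transcendental.KZ.of r₁₁ ∈ Literature.NumberTheory.Transcendental.KZ.relations :=
  LegendreHeckeTrace_of stub_landenDescending stub_landenAscending stub_cuspHalf stub_eigenIdentity stub_auxRepsExist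

end Summit.KontsevichZagierPeriods.KontsevichZagierPeriods.Cruxes.DeltaRatioHecke.HeckeTraceBirth

end
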